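import Summits.HodgeConjecture.HodgeConjecture.Theorems.NikulinTwinTransportHodgeSimilitudeAlgebraicTwinTransport
import Literature.AlgebraicGeometry.HodgeTheory.GlobalInvariantCycles
import Literature.AlgebraicGeometry.HodgeTheory.AtiyahClassTraceReal
import Literature.AlgebraicGeometry.HodgeTheory.ChernCharacterBetti
import Literature.AlgebraicGeometry.HodgeTheory.HodgeConjectureQbarVoisinProofs
import Literature.AlgebraicGeometry.Motives.CartierDivisor
import HarnessLib
import HarnessLib.Audit

/-!
# Line `semiregular-twin-hecke-vhc` — crux `NikulinTwinTransport.HodgeSimilitudeAlgebraic` (stmt-HodgeConjecture-13676)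

Skeleton of the line (crux-plan, D-0027 §3.2 (3)/§3.3): FIVE registered stubs `stub_*` (the only
`sorry`s of this file), the kernel-checked sorry-free composition
`HodgeSimilitudeAlgebraic_of_stubs : ChernCharacterOnBetti → SemiregularVariationalHodge →
SemiregularTwinCarriers → AnchoredTwinHeckeFamilies → CorrespondenceComposition →
HodgeIsometryAlgebraic → crux`, and the skeleton theorem
`HodgeSimilitudeAlgebraic_of (hB : HodgeIsometryAlgebraic) : HodgeSimilitudeAlgebraic` (concludes
the crux BY NAME modulo the stubs and the route's own item `HodgeIsometryAlgebraic` = Buskin's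
theorem, stmt-HodgeConjecture-13675, an admissible registered obligation).

IDEA (crux idea card `semiregular-twin-hecke-vhc`, merged by the triage panel with
`semiregular-hecke-twin`; TRIAGE r1-1/2/3: pass ×3). Replace the route's informal twistor transport
by Buchweitz–Flenner–Pridham–Perry SEMIREGULAR DEFORMATION: a semiregular object on ONE anchor
fourfold `S₀ × S₀″` whose Chern character carries a non-zero multiple of the twin class
`graph(Ψ₀)` deforms along the (algebraic, 19-dimensional, connected) polarised twin Hecke
correspondence, and Perry's global clause (arXiv:2604.00511, Thm 1.1 (2), READ: "for every point
`s ∈ S(ℂ)` the fiber `w_s` of `w` over `s` is algebraic") makes the twin class algebraic on EVERY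
fibre — all fibres are products of two PROJECTIVE K3 surfaces, so no Kähler barrier is met.
By the LANDED reduction `hodgeSimilitudeAlgebraic_of_prime_anchors`
(Theorems/NikulinTwinTransportHodgeSimilitudeAlgebraicPrimes.lean: Buskin + composition of
correspondences + ONE algebraic anchor `q`-similitude `AnchorAt[q]` for every projective K3 and every
prime `q` ⟹ the crux) the line only has to deliver `AnchorAt[q]`.

THE FIVE STUBS (`theorem stub_<Name> : <Name> := by sorry`; statements are the defs `<Name> : Prop`):
* `ChernCharacterOnBetti` — CONSTRUCTION of an instance of the tree's hypothesis structure
  `HodgeTheory.ChernCharacterBetti` (Chern character of algebraic vector bundles in `H²ⁱ(X(ℂ); ℂ)`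
  with Fulton/Voisin/Deligne's printed properties). Size L (formal).
* `SemiregularVariationalHodge` — Perry 2026 Thm 1.1 (2) ⊇ Buchweitz–Flenner 2003 Thm 5.1 /
  Pridham / Bandiera–Lepri–Manetti, SPECIALISED to what the line consumes and to the tree's REAL
  carriers: a smooth projective family of fourfolds over a smooth connected quasi-projective base,
  a finite locally free `E₀` on a scheme isomorphic to one fibre which is `{0,1}`-semiregular
  (`HodgeTheory.IsZeroOneSemiregular`: `(σ₀, σ₁)` injective on Mathlib's `Ext²(E₀,E₀)` — CONSTRUCTED
  in `AtiyahClassTraceReal`, no decoration, and it implies semiregularity), flat (= continuous in the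
  étalé topology of `FiberClass`) rational Hodge sections through `ch₁, ch₂, ch₃` of `E₀`
  ⟹ the `ch₂`-section is an algebraic class on every fibre (degrees `0` and `8` of `w` are
  automatic: rank and top degree). Size XL to formalise, citable (published theorem).
* `SemiregularTwinCarriers` — THE BET (hardest): for every prime `q` a rational `q`-similitude `M`
  of the K3 lattice such that for every polarisation type `u ∈ Λ`, `u² > 0`, and every reference
  period `x ⊥ u` (fixing the connected component) there is a marked projective `M`-twin ANCHOR
  `(S₀, η₀; S₀″, η₀″)` of type `u` in `x`'s component, AMPLE-NORMALISED (`η₀⁻¹ u` and `η₀″⁻¹(N u)`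
  span ample lines — the chamber condition under which the twin class `graph(η₀⁻¹ M η₀″)` is a
  FLAT class of the polarised Hecke family), carrying a finite locally free `{0,1}`-semiregular `E₀`
  on `S₀ × S₀″` with CLEAN Chern data (`CleanChern[…]`): `c₁ ∈ ⟨h₀⊗1, 1⊗h₀″⟩`,
  `ch₂ = m·Γ₀ + a·h₀⊗h₀″ + u₁·pt⊗1 + u₂·1⊗pt` with `m ≠ 0` and `Γ₀` rational acting as the twin
  similitude, `ch₃ ∈ ⟨h₀⊗pt, pt⊗h₀″⟩` — exactly the flat-Hodge span of the twin Hecke family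
  (monodromy invariants `End(Λ″_ℚ)^{Γ″} = ⟨id, pr_{u″}⟩`). Budget: `dim Ext² ≤ h^{0,2}+h^{1,3} = 42`.
* `AnchoredTwinHeckeFamilies` — the twin Hecke correspondence as an ALGEBRAIC FAMILY (Baily–Borel /
  CDK, universal families with level structure, a smooth connected quasi-projective scheme cover,
  flatness and Hodge-ness of the twin / polarisation / point classes): for every target projective K3
  `S` there are a type `u` and a reference period `x` such that EVERY ample-normalised anchor of type
  `(u, x)` with a clean semiregular carrier lies together with `S` on one such family, with flat
  rational Hodge sections THROUGH `ch₁, ch₂, ch₃` of the carrier, the degree-4 section restricting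
  on the fibre `≅ S × S″` to `m′·Γ + δ`, `m′ ≠ 0`, `δ` algebraic, `Γ` acting as a linear equivalence
  `Ψ : H²(S″) ≃ H²(S)` with the three `AnchorAt` properties. Known geometry; size L.
* `CorrespondenceComposition` — composition of algebraic correspondences between smooth projective
  surfaces (Fulton §16.1), VERBATIM the hypothesis `CompCorr` of the landed reduction (in-tree
  reduction to Gysin base change + the moving input exists: `Surfaces/K3CorrespondenceComposition`).
COMPOSITION `HodgeSimilitudeAlgebraic_of_stubs` (sorry-free): fix `q`, a target `S`; carriers give
`M` and, for the type `(u, x)` chosen by the family stub, an anchor + `E₀`; the family stub gives the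
family through that anchor and `S`; `SemiregularVariationalHodge` gives algebraicity of the flat
degree-4 class on the fibre over `S`; transport along the isomorphism `fibre ≅ S ⊗ S″`
(`map_mem_algebraicClasses_of_isOpenImmersion`), subtract `δ`, divide by `m′`: `Γ` is algebraic,
which is `AnchorAt[q]`; `hodgeSimilitudeAlgebraic_of_prime_anchors` concludes.

DISPROOF USED. No `Disproof.lean` workfile is published for this crux (`ledger crux cat
stmt-HodgeConjecture-13676 Disproof.lean` → none; the payload path under run/gate/evidence is not
mounted on this hub); the cdisprove evidence NOTES v1–v4 on the item were used: `crux_iff_squarefree` /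
`atC_sq_mul` / `primes_suffice` (prime multipliers + composition + a twin pair per prime) — honoured:
the line works prime by prime through the LANDED `hodgeSimilitudeAlgebraic_of_prime_anchors`, and
`CompCorr` is an explicit stub, not hidden glue; v3 (Kummer anchors at every odd `p`, integral
completion, algebraic graph) and v4 (known region `T_ℚ ↪ U³_ℚ`) — anchor SUPPLY is not where the
risk is, consistent with ranking `SemiregularTwinCarriers` (the carrier, not the anchor pair) hardest;
`no_antisimilitude` — no sign branch is used. Negatives index (`ledger negatives --problem
HodgeConjecture`): no stub is an instance of a refuted statement (no E-line / twistor connectivity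
statement occurs). Landed Negative lemmas checked against: `SemiregularSeedsOnAnchors/Negative/
SemiregularityCarrier.lean` (`not_isSemiregular_killTrace`, `isSemiregular_tautological`: a closed
typing over the DECORATED interface `SemiregularityMap` is vacuous/refutable) — evaded by typing
semiregularity with the CONSTRUCTED `IsZeroOneSemiregular` of finite locally free modules; its
forced-kernel principle `finrank_ext_le_of_isSemiregular` is the budget `ext² ≤ 42` recorded above.

TRIAGE ANSWERS. (r1-1/r1-3) the `Deligne2000_…_chernSpan_deg24` dependence is replaced by the real
`ChernCharacterBetti` (field `ch_mem_algebraicClasses`) + the construction stub; (r1-2, panel) ALL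
of `ch₁, ch₂, ch₃` are constrained to the generically-Hodge span, not only `ch₂` (`CleanChern[…]`);
(r1-2) Perry's G-equivariant relaxation is NOT used (no group along the twin family); (r1-3)
semiregularity is typed over a constructed Atiyah class/trace (bundles), never over a decoration;
(merge) the carrier menu of `semiregular-hecke-twin` (McKay/BKR kernels, cleaning by cones) is the
intended source of `E₀` — as BUNDLES: locally free resolutions/kernels of the cleaned complexes.
-/

noncomputable section

open CategoryTheory MonoidalCategory AlgebraicGeometry
open scoped Manifold
open Literature.AlgebraicGeometry.Motives Literature.AlgebraicGeometry.HodgeTheory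
open Literature.AlgebraicGeometry.Surfaces Literature.Geometry.Kaehler
open Literature.AlgebraicTopology.SingularHomology
open Summit.HodgeConjecture.HodgeConjecture.Theses.NikulinTwinTransport
open Summit.HodgeConjecture.HodgeConjecture.Theorems.NikulinTwinTransport

namespace Summit.HodgeConjecture.HodgeConjecture.Cruxes.HodgeSimilitudeAlgebraic.SemiregularTwinHeckeVhc

/-! ## Local notations (verbatim those of the landed Theorems files of this crux) -/

/-- `K3[S]`: the body of `IsK3Surface S` (unfolded, exactly as in the route decls / `AnchorAt`). -/
local notation3 (prettyPrint := false) "K3[" S "]" =>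
  (IsSmoothProjective 2 S ∧ Subsingleton (structureSheafCohomology (S).left 1) ∧
    ∃ (A : HodgeModel 2 S) (η : MForm 𝓘(ℝ, A.model) A.carrier ℂ 2),
      IsHolomorphicInCharts η ∧ ∀ x, η x ≠ 0)

/-- `MarkedK3[S, η, p, x]`: a marked K3 surface with period `x`. Verbatim from the Transfer file. -/
local notation3 (prettyPrint := false) "MarkedK3[" S ", " η ", " p ", " x "]" =>
  (IsIntegralClass p ∧
    (∀ q : complexBetti S (2 * 2), IsIntegralClass q → ∃ n : ℤ, q = n • p) ∧
    (∀ c : complexBetti S (2 * 1), IsIntegralClass c ↔ ∃ v : K3Index → ℤ, η c = fun i => (v i : ℂ)) ∧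
    (∀ a b : complexBetti S (2 * 1),
        cupProduct (rfl : 2 * 1 + 2 * 1 = 2 * 2) a b = k3Form (η a) (η b) • p) ∧
    IsOfHodgeType 2 S (2 * 1) 2 0 (LinearEquiv.symm η x) ∧
    (∀ τ : complexBetti S (2 * 1), IsOfHodgeType 2 S (2 * 1) 2 0 τ → ∃ t : ℂ, τ = t • LinearEquiv.symm η x))

/-- `PeriodPt[x]`: a projective period point. Verbatim from the Transfer file. -/
local notation3 (prettyPrint := false) "PeriodPt[" x "]" =>
  (k3Form x x = 0 ∧ 0 < (k3Form (star x) x).re ∧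
    ∃ u : K3Index → ℤ, k3Form (fun i => (u i : ℂ)) x = 0 ∧ 0 < ∑ i, ∑ j, u i * k3Gram i j * u j)

/-- `Corr[μ, S, S', hS, hS' ; γ, y] = [γ]_* y`. Verbatim from the Transfer file. -/
local notation3 (prettyPrint := false) "Corr[" μ ", " S ", " S' ", " hS ", " hS' " ; " γ ", " y "]" =>
  complexGysin μ
    (IsSmoothProjective.tensor_holds (IsK3Surface.isSmoothProjective hS)
      (IsK3Surface.isSmoothProjective hS'))
    (IsK3Surface.isSmoothProjective hS) (SemiCartesianMonoidalCategory.fst S S')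
    (rfl : 2 * 1 + 2 * 2 + 2 * 2 = 2 * 1 + 2 * (2 + 2))
    (cupProduct (rfl : 2 * 1 + 2 * 2 = 2 * 1 + 2 * 2)
      (complexBetti.map (SemiCartesianMonoidalCategory.snd S S') (2 * 1) y) γ)

/-- `RatSimil[c, M, N]`: `M` is a `ℂ`-linear `c`-similitude of `(Λ_ℂ, k3Form)` defined over `ℚ` with
two-sided inverse `N` defined over `ℚ` — verbatim the five hypotheses of `RatTwinTransportAt[c]`. -/
local notation3 (prettyPrint := false) "RatSimil[" c ", " M ", " N "]" =>
  ((∀ v : K3Index → ℤ, ∃ w : K3Index → ℚ, M (fun i => (v i : ℂ)) = fun i => (w i : ℂ)) ∧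
    (∀ v : K3Index → ℤ, ∃ w : K3Index → ℚ, N (fun i => (v i : ℂ)) = fun i => (w i : ℂ)) ∧
    M * N = 1 ∧ N * M = 1 ∧ ∀ a b, k3Form (M a) (M b) = c * k3Form a b)

/-- `CompCorr`: composition of algebraic correspondences between smooth projective surfaces.
Verbatim from `NikulinTwinTransportHodgeSimilitudeAlgebraicPrimes`. -/
local notation3 (prettyPrint := false) "CompCorr" =>
  ∀ (μ : OrientationFamily), μ.HasPoincareDuality →
    ∀ (A B C : SchemeOver ℂ) (hA : IsSmoothProjective 2 A) (hB : IsSmoothProjective 2 B)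
      (hC : IsSmoothProjective 2 C),
      ∀ γ ∈ algebraicClasses (MonoidalCategoryStruct.tensorObj A B) 2,
        ∀ γ₁ ∈ algebraicClasses (MonoidalCategoryStruct.tensorObj B C) 2,
          ∃ γ₂ ∈ algebraicClasses (MonoidalCategoryStruct.tensorObj A C) 2,
            ∀ x : complexBetti C (2 * 1),
              complexGysin μ (IsSmoothProjective.tensor_holds hA hC) hA
                  (SemiCartesianMonoidalCategory.fst A C)
                  (rfl : 2 * 1 + 2 * 2 + 2 * 2 = 2 * 1 + 2 * (2 + 2))
                  (cupProduct (rfl : 2 * 1 + 2 * 2 = 2 * 1 + 2 * 2)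
                    (complexBetti.map (SemiCartesianMonoidalCategory.snd A C) (2 * 1) x) γ₂) =
                complexGysin μ (IsSmoothProjective.tensor_holds hA hB) hA
                  (SemiCartesianMonoidalCategory.fst A B)
                  (rfl : 2 * 1 + 2 * 2 + 2 * 2 = 2 * 1 + 2 * (2 + 2))
                  (cupProduct (rfl : 2 * 1 + 2 * 2 = 2 * 1 + 2 * 2)
                    (complexBetti.map (SemiCartesianMonoidalCategory.snd A B) (2 * 1)
                      (complexGysin μ (IsSmoothProjective.tensor_holds hB hC) hB
                        (SemiCartesianMonoidalCategory.fst B C)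
                        (rfl : 2 * 1 + 2 * 2 + 2 * 2 = 2 * 1 + 2 * (2 + 2))
                        (cupProduct (rfl : 2 * 1 + 2 * 2 = 2 * 1 + 2 * 2)
                          (complexBetti.map (SemiCartesianMonoidalCategory.snd B C) (2 * 1) x)
                          γ₁)))
                    γ)

/-! ## Auxiliary local notations of the line (no declarations) -/

/-- `AmpleLine[S, hS, h]` — **the line `ℂ·h` contains an ample class.** `S` smooth projective (hence
integral, `IsSmoothProjective.isIntegral_holds`), `h ∈ H²(S(ℂ); ℂ)`: there is an EFFECTIVE
(`1 ∈ Γ(𝒪(D))`, `CartierDivisor.IsSection 1`) AMPLE Cartier divisor `D` with IRREDUCIBLE support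
`|D| = (S_1)ᶜ` (`CartierDivisor.nonvanishing 1`) such that `h` dies on `S ∖ |D|`, i.e.
`h ∈ Im(H²_{|D|}(S) → H²(S)) = ℂ·cl(|D|)` (Fulton Lemma 19.1.1: for an irreducible curve `|D|` this
image is the line of its class). This is the tree-expressible form of "`±h` is a positive multiple of
an ample class" (Bertini: a very ample multiple of an ample class has an irreducible member), used to
NORMALISE markings to the Kähler chamber: a lattice Hodge isometry carrying one ample class to `±` an
ample class is `±`effective (Torelli), so the universal fibre of the polarised family is identified
with the anchor WITHOUT a Weyl twist, and the twin class of the anchor's own marking is the flat one. -/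
local notation3 (prettyPrint := false) "AmpleLine[" S ", " hS ", " h "]" =>
  (haveI : IsIntegral (S).left := IsSmoothProjective.isIntegral_holds hS
    ∃ D : CartierDivisor (S).left, D.IsAmple ∧ D.IsSection 1 ∧ IsPreirreducible (D.nonvanishing 1)ᶜ ∧
      complexBetti.restrictCompl S (D.nonvanishing 1)ᶜ (2 * 1) h = 0)

/-- `CleanChern[C, S₀, S₀″, p₀, p₀″, h₀, h₀″, Γ₀, E₀]` — **clean Chern data** of a module `E₀` on
`S₀ ⊗ S₀″` relative to polarisation classes `h₀, h₀″`, point generators `p₀, p₀″` and a twin class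
`Γ₀`: `ch₁(E₀) ∈ ℂ·h₀⊗1 + ℂ·1⊗h₀″`, `ch₂(E₀) = m·Γ₀ + a·h₀⊗h₀″ + u₁·p₀⊗1 + u₂·1⊗p₀″` with
`m ≠ 0`, `ch₃(E₀) ∈ ℂ·h₀⊗p₀″ + ℂ·p₀⊗h₀″` — the (complexified) flat-Hodge span of the polarised twin
Hecke family in degrees `2, 4, 6` (monodromy invariants; degrees `0, 8` are automatic; the `chₖ` are
rational classes anyway, `ChernCharacterBetti.isRationalClass_ch`). Coefficients are COMPLEX on
purpose: the class `Γ₀` realising a given action `[Γ₀]_*` relative to an orientation family `μ` is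
the topological twin class divided by the unit `c_μ ∈ ℂˣ` by which `complexGysin μ` differs from the
complex orientation (`complexGysin_eq_smul_of_orientationFamily`), so `m = m₀ c_μ` need not be
rational; `C` is the Chern character parameter, and every clause is invariant under the rescalings
`chᵢ ↦ λⁱ chᵢ` that the fields of `ChernCharacterBetti` do not exclude. -/
local notation3 (prettyPrint := false)
    "CleanChern[" C ", " S₀ ", " S₀'' ", " p₀ ", " p₀'' ", " h₀ ", " h₀'' ", " Γ₀ ", " E₀ "]" =>
  ((∃ a₁ a₂ : ℂ, ChernCharacterBetti.ch C (S₀ ⊗ S₀'') E₀ 1 =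
      a₁ • complexBetti.map (SemiCartesianMonoidalCategory.fst S₀ S₀'') (2 * 1) h₀ +
        a₂ • complexBetti.map (SemiCartesianMonoidalCategory.snd S₀ S₀'') (2 * 1) h₀'') ∧
  (∃ m a u₁ u₂ : ℂ, m ≠ 0 ∧ ChernCharacterBetti.ch C (S₀ ⊗ S₀'') E₀ 2 =
      m • Γ₀ +
        a • cupProduct (rfl : 2 * 1 + 2 * 1 = 2 * 2)
          (complexBetti.map (SemiCartesianMonoidalCategory.fst S₀ S₀'') (2 * 1) h₀)
          (complexBetti.map (SemiCartesianMonoidalCategory.snd S₀ S₀'') (2 * 1) h₀'') +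
        u₁ • complexBetti.map (SemiCartesianMonoidalCategory.fst S₀ S₀'') (2 * 2) p₀ +
        u₂ • complexBetti.map (SemiCartesianMonoidalCategory.snd S₀ S₀'') (2 * 2) p₀'') ∧
  (∃ b₁ b₂ : ℂ, ChernCharacterBetti.ch C (S₀ ⊗ S₀'') E₀ 3 =
      b₁ • cupProduct (rfl : 2 * 1 + 2 * 2 = 2 * 3)
          (complexBetti.map (SemiCartesianMonoidalCategory.fst S₀ S₀'') (2 * 1) h₀)
          (complexBetti.map (SemiCartesianMonoidalCategory.snd S₀ S₀'') (2 * 2) p₀'') +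
        b₂ • cupProduct (rfl : 2 * 2 + 2 * 1 = 2 * 3)
          (complexBetti.map (SemiCartesianMonoidalCategory.fst S₀ S₀'') (2 * 2) p₀)
          (complexBetti.map (SemiCartesianMonoidalCategory.snd S₀ S₀'') (2 * 1) h₀'')))

/-- `TwinAnchor[μ, M, N, u, x, S₀, S₀″, hS₀, hS₀″, η₀, p₀, x₀, η₀″, p₀″, x₀″, Γ₀]` — **a marked
projective `M`-twin anchor of polarisation type `u` in the component of the reference period `x`,
ample-normalised, with twin class `Γ₀`.** `(S₀, η₀, p₀, x₀)` and `(S₀″, η₀″, p₀″, x₀″)` are marked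
projective K3 surfaces (`MarkedK3`, `PeriodPt`, shapes of the Huybrechts K3 facts) with `M x₀″ ∝ x₀`
(the twin similitude `η₀⁻¹ ∘ M ∘ η₀″ : H²(S₀″) → H²(S₀)` preserves the period line, hence Hodge types);
`x₀ ⊥ u` (the class `h₀ = η₀⁻¹ u` is of type `(1,1)` on `S₀`); `x₀` lies in the same connected
component of the period domain in `u^⊥` as `x` (signature `(2,19)`: the orthogonal projection between
positive 2-planes preserves orientation iff `|(x₀.x̄)| > |(x₀.x)|`); the lines of `h₀ = η₀⁻¹ u` on
`S₀` and of `h₀″ = η₀″⁻¹ (N u)` on `S₀″` contain ample classes (`AmpleLine`); and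
`Γ₀ ∈ H⁴((S₀ × S₀″)(ℂ))` is a class acting (relative to `μ`) as the twin similitude,
`[Γ₀]_* = η₀⁻¹ M η₀″` (it is `c_μ⁻¹` times the rational topological twin class, up to the point
classes `pt⊗1, 1⊗pt″`, which act by zero). -/
local notation3 (prettyPrint := false) "TwinAnchor[" μ ", " M ", " N ", " u ", " x ", " S₀ ", " S₀''
    ", " hS₀ ", " hS₀'' ", " η₀ ", " p₀ ", " x₀ ", " η₀'' ", " p₀'' ", " x₀'' ", " Γ₀ "]" =>
  (MarkedK3[S₀, η₀, p₀, x₀] ∧ PeriodPt[x₀] ∧ MarkedK3[S₀'', η₀'', p₀'', x₀''] ∧ PeriodPt[x₀''] ∧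
    (∃ t : ℂ, M x₀'' = t • x₀) ∧ k3Form (fun i => ((u : K3Index → ℤ) i : ℂ)) x₀ = 0 ∧
    ‖k3Form x₀ x‖ < ‖k3Form x₀ (star x)‖ ∧
    AmpleLine[S₀, (IsK3Surface.isSmoothProjective hS₀),
      ((η₀ : complexBetti S₀ (2 * 1) ≃ₗ[ℂ] (K3Index → ℂ)).symm (fun i => ((u : K3Index → ℤ) i : ℂ)))] ∧
    AmpleLine[S₀'', (IsK3Surface.isSmoothProjective hS₀''),
      ((η₀'' : complexBetti S₀'' (2 * 1) ≃ₗ[ℂ] (K3Index → ℂ)).symm (N (fun i => ((u : K3Index → ℤ) i : ℂ))))] ∧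
    ∀ y, (η₀ : complexBetti S₀ (2 * 1) ≃ₗ[ℂ] (K3Index → ℂ)).symm (M (η₀'' y)) =
      Corr[μ, S₀, S₀'', hS₀, hS₀'' ; Γ₀, y])

/-! ## The stub statements -/

/-- STUB 1 (construction, L). **A Chern character of algebraic vector bundles on the real carriers
exists**: an instance of the hypothesis structure `HodgeTheory.ChernCharacterBetti` — data
`chᵢ(E) ∈ H²ⁱ(X(ℂ); ℂ)` with additivity, functoriality, normalisation on trivial/line bundles,
rationality, and on smooth projective `X` algebraicity + span (Fulton §15.1, Ex. 15.2.16, Prop. 19.1.2;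
Voisin I Thm 11.23/11.32; Deligne 2000 §2 (ii)). The tree deliberately records no `Nonempty` fact
(D-0026): the instance is a CONSTRUCTION (splitting principle / projective bundles on `X(ℂ)`). -/
def ChernCharacterOnBetti : Prop :=
  Nonempty ChernCharacterBetti

/-- STUB 2 (the engine, XL / citable). **Semiregular variational Hodge for bundles on families of
fourfolds** (Perry 2026, arXiv:2604.00511 Thm 1.1 (2), with `B₀ = 0` and `E₀` a sheaf; Buchweitz–Flenner
2003 Thm 5.1; Pridham; Bandiera–Lepri–Manetti Cor. 1.2), on real carriers. Let `f : 𝒲 → B` be a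
smooth projective family of relative dimension `4` over a smooth quasi-projective base with `B(ℂ)`
connected; let `τ₁, τ₂, τ₃` be FLAT (continuous as sections of the étalé spaces `FiberClass f (2k)`)
sections of `R^{2k} f_* ℂ`, `k = 1, 2, 3`, with values in the locus of Hodge classes (rational, of
type `(k,k)`) at every point; let `E₀` be a finite locally free module on a scheme `W₀` isomorphic to
the fibre over `b₀` which is `{0,1}`-semiregular (`(σ₀, σ₁) : Ext²(E₀,E₀) → H²(𝒪) ⊕ H³(Ω¹)`
injective — this implies semiregularity) and whose Chern character components `ch₁, ch₂, ch₃` are the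
values of `τ₁, τ₂, τ₃` at `b₀`. Then the value of `τ₂` at EVERY point is an algebraic class of its
fibre. (Perry: "`w₀ = exp(B₀)·ch(E₀)` remains Hodge along `S`, i.e. lifts to a global section `w` of
`⊕ R^{2k} f_* ℚ(k)` ⟹ for every `s ∈ S(ℂ)` the fiber `w_s` is algebraic"; the degree-`0` and
top-degree-`8` components of `w` exist and are algebraic automatically — rank, and `H⁸ = ℂ·pt` on a
connected fourfold, `mem_algebraicClasses_of_degree_top`; `Ext^{<0} = 0` for a sheaf.)
[cite: Perry2026Semiregularity, Thm. 1.1 (2)] [cite: BuchweitzFlenner2003, Thm. 5.1] -/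
def SemiregularVariationalHodge : Prop :=
  ∀ (C : ChernCharacterBetti) (𝒲 B : SchemeOver ℂ) (f : 𝒲 ⟶ B),
    IsSmoothProjectiveFamily f 4 → IsQuasiProjectiveOver B → Smooth B.hom →
    ConnectedSpace (ComplexPoints B) →
    ∀ (τ₁ : ∀ s : ComplexPoints B, complexBetti (fiberOver f s) (2 * 1))
      (τ₂ : ∀ s : ComplexPoints B, complexBetti (fiberOver f s) (2 * 2))
      (τ₃ : ∀ s : ComplexPoints B, complexBetti (fiberOver f s) (2 * 3)),
      Continuous (fun s => (⟨s, τ₁ s⟩ : FiberClass f (2 * 1))) →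
      Continuous (fun s => (⟨s, τ₂ s⟩ : FiberClass f (2 * 2))) →
      Continuous (fun s => (⟨s, τ₃ s⟩ : FiberClass f (2 * 3))) →
      (∀ s, (⟨s, τ₁ s⟩ : FiberClass f (2 * 1)) ∈ locusOfHodgeClasses f 4 1) →
      (∀ s, (⟨s, τ₂ s⟩ : FiberClass f (2 * 2)) ∈ locusOfHodgeClasses f 4 2) →
      (∀ s, (⟨s, τ₃ s⟩ : FiberClass f (2 * 3)) ∈ locusOfHodgeClasses f 4 3) →
    ∀ (b₀ : ComplexPoints B) (W₀ : SchemeOver ℂ) (e₀ : fiberOver f b₀ ≅ W₀)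
      (E₀ : W₀.left.Modules) (hE₀ : IsFiniteLocallyFree E₀),
      IsZeroOneSemiregular hE₀ →
      τ₁ b₀ = complexBetti.map e₀.hom (2 * 1) (C.ch W₀ E₀ 1) →
      τ₂ b₀ = complexBetti.map e₀.hom (2 * 2) (C.ch W₀ E₀ 2) →
      τ₃ b₀ = complexBetti.map e₀.hom (2 * 3) (C.ch W₀ E₀ 3) →
    ∀ s : ComplexPoints B, τ₂ s ∈ algebraicClasses (fiberOver f s) 2

/-- STUB 3 (THE BET; hardest). **Semiregular twin carriers at ample-normalised anchors of every
polarisation type.** For every prime `q` there is a rational `q`-similitude `M` of `(Λ_ℂ, k3Form)`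
with rational inverse `N` (they exist for every `q`, `exists_ratSimilitude_k3Lattice`; the choice is
the carrier-builder's, e.g. the lattice map of a degree-`q` Kummer isogeny correspondence, BSV
arXiv:1510.07465 §6.5, or a Gauss-sum/CM anchor) such that: for every Chern character theory `C`,
every orientation family `μ`, every polarisation TYPE `u ∈ Λ` with `u² > 0` and every reference
projective period `x ⊥ u`, there is a marked projective `M`-twin anchor `(S₀, η₀; S₀″, η₀″)` of type `u`
in `x`'s component, ample-normalised, with twin class `Γ₀` (`TwinAnchor[…]`), carrying a finite locally
free `E₀` on `S₀ × S₀″` which is `{0,1}`-SEMIREGULAR (`(σ₀, σ₁)` injective on `Ext²(E₀,E₀)`; budget: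
`dim Ext²(E₀,E₀) ≤ h^{0,2} + h^{1,3} = 2 + 40`) and has CLEAN Chern data (`CleanChern[…]`: `c₁` in
the polarisation span, `ch₂ = m·Γ₀ + a·h₀⊗h₀″ + points` with `m ≠ 0`, `ch₃` in the polarisation⊗point
span). Why it might fail: Fourier–Mukai-type kernels have `ext² = 24q − 2 > 44` (card), the route's
rank-2 Serre sheaf has `χ ≫ 46`, and cleaning the NS⊗NS″ part of a McKay/BKR kernel into
`ℚ·h₀⊗h₀″` while keeping `(σ₀,σ₁)` injective is exactly the open step named by the triage panel.
[cite: Perry2026Semiregularity, Def. 2.4] [cite: BuchweitzFlenner2003, Def. 4.1 and §5] -/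
def SemiregularTwinCarriers : Prop :=
  ∀ q : ℕ, q.Prime →
    ∃ (M N : Module.End ℂ (K3Index → ℂ)), RatSimil[((q : ℕ) : ℂ), M, N] ∧
      ∀ (C : ChernCharacterBetti) (μ : OrientationFamily), μ.HasPoincareDuality →
      ∀ (u : K3Index → ℤ), 0 < ∑ i, ∑ j, u i * k3Gram i j * u j →
      ∀ (x : K3Index → ℂ), PeriodPt[x] → k3Form (fun i => (u i : ℂ)) x = 0 →
        ∃ (S₀ S₀'' : SchemeOver ℂ) (hS₀ : IsK3Surface S₀) (hS₀'' : IsK3Surface S₀'')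
          (η₀ : complexBetti S₀ (2 * 1) ≃ₗ[ℂ] (K3Index → ℂ)) (p₀ : complexBetti S₀ (2 * 2))
          (x₀ : K3Index → ℂ) (η₀'' : complexBetti S₀'' (2 * 1) ≃ₗ[ℂ] (K3Index → ℂ))
          (p₀'' : complexBetti S₀'' (2 * 2)) (x₀'' : K3Index → ℂ)
          (Γ₀ : complexBetti (S₀ ⊗ S₀'') (2 * 2)) (E₀ : (S₀ ⊗ S₀'').left.Modules)
          (hE₀ : IsFiniteLocallyFree E₀),
          TwinAnchor[μ, M, N, u, x, S₀, S₀'', hS₀, hS₀'', η₀, p₀, x₀, η₀'', p₀'', x₀'', Γ₀] ∧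
          IsZeroOneSemiregular hE₀ ∧
          CleanChern[C, S₀, S₀'', p₀, p₀'', (η₀.symm (fun i => (u i : ℂ))),
            (η₀''.symm (N (fun i => (u i : ℂ)))), Γ₀, E₀]

/-- STUB 4 (known geometry, L). **Anchored twin Hecke families.** Fix `C`, an orientation family `μ`,
`q`, and a rational `q`-similitude `M` (inverse `N`) of the K3 lattice. For every projective K3
surface `S` (integral generator `p` of `H⁴`) there are a polarisation type `u` (`u² > 0`) and a
reference projective period `x ⊥ u` — in the intended proof: `u = η(h)` for an ample class `h` of `S`
and a marking `η`, `x` the period of `(S, η)` — such that for EVERY ample-normalised marked projective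
`M`-twin anchor `(S₀, η₀; S₀″, η₀″)` of type `u` in `x`'s component with twin class `Γ₀` and every
finite locally free `{0,1}`-semiregular `E₀` on `S₀ × S₀″` with clean Chern data, there is a smooth
projective family `f : 𝒲 → B` of fourfolds over a smooth quasi-projective base with `B(ℂ)` connected
(a smooth connected scheme cover of the polarised twin Hecke correspondence `Γ_{M,u}∖Ω_{u″^⊥}`:
Baily–Borel, universal families with level structure, Kresch–Vistoli + resolution), flat sections
`τ₁, τ₂, τ₃` of `R^{2,4,6} f_* ℂ` in the locus of Hodge classes everywhere (flat span = ⟨u⊗1, 1⊗u″⟩,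
⟨graph M, u⊗u″, pt⊗1, 1⊗pt⟩, ⟨u⊗pt, pt⊗u″⟩ by the monodromy computation; Hodge since every fibre is a
polarised twin pair), a point `b₀` whose fibre is identified with `S₀ ⊗ S₀″` so that `τₖ(b₀) = chₖ(E₀)`
(`k = 1,2,3`; the ample normalisation makes the Torelli identification effective, so the anchor's OWN
twin class is the flat one), and a point `b` whose fibre is identified with `S ⊗ S″` for a projective K3
partner `S″` (generator `p″`) with a `ℂ`-linear equivalence `Ψ : H²(S″) ≃ H²(S)` whose inverse is
rational, type-preserving and divides the cup form by `q` (the three properties of `AnchorAt[q]`), a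
class `Γ` with `[Γ]_* = Ψ`, such that `τ₂(b)` corresponds to `m′·Γ + δ` with `m′ ≠ 0` and `δ`
an algebraic class on `S ⊗ S″` (the NS⊗NS″, polarisation and point parts).
[cite: CattaniDeligneKaplan1995JAMS, Cor. 1.2] [cite: CharlesSchnell2014Notes, Prop. 11.3.5] -/
def AnchoredTwinHeckeFamilies : Prop :=
  ∀ (C : ChernCharacterBetti) (μ : OrientationFamily), μ.HasPoincareDuality →
  ∀ (q : ℕ) (M N : Module.End ℂ (K3Index → ℂ)), RatSimil[((q : ℕ) : ℂ), M, N] →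
  ∀ (S : SchemeOver ℂ) (hS : K3[S]) (p : complexBetti S (2 * 2)),
    (IsIntegralClass p ∧ ∀ q' : complexBetti S (2 * 2), IsIntegralClass q' → ∃ n : ℤ, q' = n • p) →
    ∃ (u : K3Index → ℤ), 0 < ∑ i, ∑ j, u i * k3Gram i j * u j ∧
    ∃ (x : K3Index → ℂ), PeriodPt[x] ∧ k3Form (fun i => (u i : ℂ)) x = 0 ∧
    ∀ (S₀ S₀'' : SchemeOver ℂ) (hS₀ : IsK3Surface S₀) (hS₀'' : IsK3Surface S₀'')
      (η₀ : complexBetti S₀ (2 * 1) ≃ₗ[ℂ] (K3Index → ℂ)) (p₀ : complexBetti S₀ (2 * 2))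
      (x₀ : K3Index → ℂ) (η₀'' : complexBetti S₀'' (2 * 1) ≃ₗ[ℂ] (K3Index → ℂ))
      (p₀'' : complexBetti S₀'' (2 * 2)) (x₀'' : K3Index → ℂ)
      (Γ₀ : complexBetti (S₀ ⊗ S₀'') (2 * 2)) (E₀ : (S₀ ⊗ S₀'').left.Modules)
      (hE₀ : IsFiniteLocallyFree E₀),
      TwinAnchor[μ, M, N, u, x, S₀, S₀'', hS₀, hS₀'', η₀, p₀, x₀, η₀'', p₀'', x₀'', Γ₀] →
      IsZeroOneSemiregular hE₀ →
      CleanChern[C, S₀, S₀'', p₀, p₀'', (η₀.symm (fun i => (u i : ℂ))),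
        (η₀''.symm (N (fun i => (u i : ℂ)))), Γ₀, E₀] →
      ∃ (𝒲 B : SchemeOver ℂ) (f : 𝒲 ⟶ B),
        IsSmoothProjectiveFamily f 4 ∧ IsQuasiProjectiveOver B ∧ Smooth B.hom ∧
        ConnectedSpace (ComplexPoints B) ∧
        ∃ (τ₁ : ∀ s : ComplexPoints B, complexBetti (fiberOver f s) (2 * 1))
          (τ₂ : ∀ s : ComplexPoints B, complexBetti (fiberOver f s) (2 * 2))
          (τ₃ : ∀ s : ComplexPoints B, complexBetti (fiberOver f s) (2 * 3)),
          Continuous (fun s => (⟨s, τ₁ s⟩ : FiberClass f (2 * 1))) ∧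
          Continuous (fun s => (⟨s, τ₂ s⟩ : FiberClass f (2 * 2))) ∧
          Continuous (fun s => (⟨s, τ₃ s⟩ : FiberClass f (2 * 3))) ∧
          (∀ s, (⟨s, τ₁ s⟩ : FiberClass f (2 * 1)) ∈ locusOfHodgeClasses f 4 1) ∧
          (∀ s, (⟨s, τ₂ s⟩ : FiberClass f (2 * 2)) ∈ locusOfHodgeClasses f 4 2) ∧
          (∀ s, (⟨s, τ₃ s⟩ : FiberClass f (2 * 3)) ∈ locusOfHodgeClasses f 4 3) ∧
          ∃ (b₀ : ComplexPoints B) (e₀ : fiberOver f b₀ ≅ S₀ ⊗ S₀''),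
            τ₁ b₀ = complexBetti.map e₀.hom (2 * 1) (C.ch (S₀ ⊗ S₀'') E₀ 1) ∧
            τ₂ b₀ = complexBetti.map e₀.hom (2 * 2) (C.ch (S₀ ⊗ S₀'') E₀ 2) ∧
            τ₃ b₀ = complexBetti.map e₀.hom (2 * 3) (C.ch (S₀ ⊗ S₀'') E₀ 3) ∧
          ∃ (b : ComplexPoints B) (S'' : SchemeOver ℂ) (hS'' : K3[S''])
            (p'' : complexBetti S'' (2 * 2)),
            (IsIntegralClass p'' ∧
              ∀ q' : complexBetti S'' (2 * 2), IsIntegralClass q' → ∃ n : ℤ, q' = n • p'') ∧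
            ∃ (e : fiberOver f b ≅ S ⊗ S'')
              (Ψ : complexBetti S'' (2 * 1) ≃ₗ[ℂ] complexBetti S (2 * 1)),
              (∀ y, IsRationalClass y → IsRationalClass (Ψ.symm y)) ∧
              (∀ (i j : ℕ) y, IsOfHodgeType 2 S (2 * 1) i j y →
                IsOfHodgeType 2 S'' (2 * 1) i j (Ψ.symm y)) ∧
              (∀ (y₁ y₂ : complexBetti S (2 * 1)) (c : ℂ),
                cupProduct (rfl : 2 * 1 + 2 * 1 = 2 * 2) y₁ y₂ = (((q : ℕ) : ℂ) * c) • p →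
                  cupProduct (rfl : 2 * 1 + 2 * 1 = 2 * 2) (Ψ.symm y₁) (Ψ.symm y₂) = c • p'') ∧
              ∃ (Γ : complexBetti (S ⊗ S'') (2 * 2)),
                (∀ y : complexBetti S'' (2 * 1),
                  Ψ y = complexGysin μ (IsSmoothProjective.tensor_holds hS.1 hS''.1) hS.1
                    (SemiCartesianMonoidalCategory.fst S S'')
                    (rfl : 2 * 1 + 2 * 2 + 2 * 2 = 2 * 1 + 2 * (2 + 2))
                    (cupProduct (rfl : 2 * 1 + 2 * 2 = 2 * 1 + 2 * 2)
                      (complexBetti.map (SemiCartesianMonoidalCategory.snd S S'') (2 * 1) y) Γ)) ∧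
                ∃ (m : ℂ), m ≠ 0 ∧ ∃ δ ∈ algebraicClasses (S ⊗ S'') 2,
                  τ₂ b = complexBetti.map e.hom (2 * 2) (m • Γ + δ)

/-- STUB 5 (formal, M/L). **Algebraic correspondences between smooth projective surfaces compose**
(Fulton, Intersection Theory Prop. 16.1.1 / Def. 16.1.2; Buskin Lemma 6.3): verbatim the hypothesis
`CompCorr` of the landed reduction `hodgeSimilitudeAlgebraic_of_prime_anchors`; in the tree it is
reduced to Gysin base change for the product square + the cup product with supports
(`Surfaces/K3CorrespondenceComposition`, `HodgeTheory/CorrespondenceComposition`).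
[cite: Fulton1998, Prop. 16.1.1 and Def. 16.1.2] [cite: Buskin2019, Lemma 6.3] -/
def CorrespondenceComposition : Prop :=
  CompCorr

/-! ## Registered stubs (the only `sorry`s of the line) -/

theorem stub_ChernCharacterOnBetti : ChernCharacterOnBetti := by
  sorry

theorem stub_SemiregularVariationalHodge : SemiregularVariationalHodge := by
  sorry

theorem stub_SemiregularTwinCarriers : SemiregularTwinCarriers := by
  sorry

theorem stub_AnchoredTwinHeckeFamilies : AnchoredTwinHeckeFamilies := by
  sorry

theorem stub_CorrespondenceComposition : CorrespondenceComposition := by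
  sorry

/-! ## The composition: the five stub statements (and Buskin) imply the crux (sorry-free) -/

/-- Local alias of the crux decl, used only as the conclusion of the sorry-free composition
`HodgeSimilitudeAlgebraic_of_stubs`, so that `HodgeSimilitudeAlgebraic_of` is the unique theorem of
this file concluding the crux BY NAME (skeleton audit, D-0027 §2.1). -/
abbrev CruxStatement : Prop :=
  Summit.HodgeConjecture.HodgeConjecture.Theses.NikulinTwinTransport.HodgeSimilitudeAlgebraic

/-- Transport of algebraicity along an isomorphism of `ℂ`-schemes onto a smooth projective one:
if `c ∈ H²ᵖ(Y(ℂ))` pulls back along `e.hom : X ≅ Y` to an algebraic class of the smooth projective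
`X`, then `c` is algebraic on `Y` (`e.inv` is an open immersion; `(e.inv ≫ e.hom)^* = id`). -/
theorem mem_algebraicClasses_of_iso {n : ℕ} {X Y : SchemeOver ℂ} (hX : IsSmoothProjective n X)
    (e : X ≅ Y) {p : ℕ} {c : complexBetti Y (2 * p)}
    (hc : complexBetti.map e.hom (2 * p) c ∈ algebraicClasses X p) :
    c ∈ algebraicClasses Y p := by
  haveI : IsIso e.inv.left := by
    change IsIso ((Over.forget _).map e.inv); infer_instance
  haveI : IsOpenImmersion e.inv.left := IsOpenImmersion.of_isIso _
  have key := map_mem_algebraicClasses_of_isOpenImmersion hX e.inv hc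
  have hid : complexBetti.map e.inv (2 * p) (complexBetti.map e.hom (2 * p) c) = c := by
    change (complexBetti.map e.hom (2 * p) ≫ complexBetti.map e.inv (2 * p)) c = c
    rw [← complexBetti.map_comp, e.inv_hom_id, complexBetti.map_id]
    rfl
  rwa [hid] at key

/-- THE COMPOSITION (kernel-checked, no `sorry`). -/
theorem HodgeSimilitudeAlgebraic_of_stubs :
    ChernCharacterOnBetti → SemiregularVariationalHodge → SemiregularTwinCarriers →
      AnchoredTwinHeckeFamilies → CorrespondenceComposition → HodgeIsometryAlgebraic →
        CruxStatement := by
  intro hCh hVHC hL hG hC hB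
  obtain ⟨C⟩ := hCh
  refine hodgeSimilitudeAlgebraic_of_prime_anchors hB hC ?_
  intro q hq μ hμ S hS p hp
  obtain ⟨M, N, hMN, hLq⟩ := hL q hq
  obtain ⟨u, hu, x, hx, hxu, hGx⟩ := hG C μ hμ q M N hMN S hS p hp
  obtain ⟨S₀, S₀'', hS₀, hS₀'', η₀, p₀, x₀, η₀'', p₀'', x₀'', Γ₀, E₀, hE₀, hanchor, hsr, hclean⟩ :=
    hLq C μ hμ u hu x hx hxu
  obtain ⟨𝒲, B, f, hf, hBq, hBs, hconn, τ₁, τ₂, τ₃, hc₁, hc₂, hc₃, hh₁, hh₂, hh₃, b₀, e₀, he₁, he₂,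
      he₃, b, S'', hS'', p'', hp'', e, Ψ, hΨr, hΨt, hΨs, Γ, hΓΨ, m, hm, δ, hδ, hτb⟩ :=
    hGx S₀ S₀'' hS₀ hS₀'' η₀ p₀ x₀ η₀'' p₀'' x₀'' Γ₀ E₀ hE₀ hanchor hsr hclean
  -- Perry's theorem: the flat degree-4 class is algebraic on the fibre over `b`
  have halg : τ₂ b ∈ algebraicClasses (fiberOver f b) 2 :=
    hVHC C 𝒲 B f hf hBq hBs hconn τ₁ τ₂ τ₃ hc₁ hc₂ hc₃ hh₁ hh₂ hh₃ b₀ (S₀ ⊗ S₀'') e₀ E₀ hE₀ hsr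
      he₁ he₂ he₃ b
  -- transport along `e : fibre ≅ S ⊗ S″`
  have hX : m • Γ + δ ∈ algebraicClasses (S ⊗ S'') 2 := by
    refine mem_algebraicClasses_of_iso (hf.isSmoothProjective b) e ?_
    rw [← hτb]
    exact halg
  -- subtract the algebraic part and divide by `m ≠ 0`
  have hΓ : Γ ∈ algebraicClasses (S ⊗ S'') 2 := by
    have h1 : m • Γ ∈ algebraicClasses (S ⊗ S'') 2 := by
      have h := Submodule.sub_mem _ hX hδ
      rwa [add_sub_cancel_right] at h
    have h2 := Submodule.smul_mem (algebraicClasses (S ⊗ S'') 2) m⁻¹ h1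
    rwa [smul_smul, inv_mul_cancel₀ hm, one_smul] at h2
  exact ⟨S'', hS'', p'', hp'', Ψ, hΨr, hΨt, hΨs, Γ, hΓ, hΓΨ⟩

/-- THE SKELETON THEOREM (D-0027 §3.3): concludes the crux `HodgeSimilitudeAlgebraic` BY NAME, modulo
exactly the five registered stubs `stub_*` (the only `sorry`s of this file) and the route's own item
`HodgeIsometryAlgebraic` (Buskin's theorem, stmt-HodgeConjecture-13675, support rank 2 of route
NikulinTwinTransport — an admissible registered obligation, not re-filed as a stub). -/
theorem HodgeSimilitudeAlgebraic_of (hB : HodgeIsometryAlgebraic) :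
    Summit.HodgeConjecture.HodgeConjecture.Theses.NikulinTwinTransport.HodgeSimilitudeAlgebraic :=
  HodgeSimilitudeAlgebraic_of_stubs stub_ChernCharacterOnBetti stub_SemiregularVariationalHodge
    stub_SemiregularTwinCarriers stub_AnchoredTwinHeckeFamilies stub_CorrespondenceComposition hB

end Summit.HodgeConjecture.HodgeConjecture.Cruxes.HodgeSimilitudeAlgebraic.SemiregularTwinHeckeVhc

end
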